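import Literature.MathematicalPhysics.QuantumLattice.AndersonXYTorusBound
import HarnessLib

/-!
# Anderson's lower bound for the Heisenberg antiferromagnet: the spin-½ Heisenberg star

Trunk T-QLATTICE; sibling of `AndersonXYStarBound.lean` / `AndersonXYTorusBound.lean`.
P. W. Anderson (Phys. Rev. 83 (1951) 1260) bounded the ground-state energy of the Heisenberg
antiferromagnet from below by cutting the lattice into STARS (a site together with its `z`
neighbours): `E₀ ≥ -½NzS²(1 + 1/(zS))`. For spin ½ this is the operator inequality proved here for
the Heisenberg star `G = Σ_{y∈Y} 𝐒_x·𝐒_y = 𝐒_x·𝐋` (`x ∉ Y`, `k = |Y|`, inside an arbitrary finite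
spin-½ system `Λ`):

* `heisStar_mul_self`: **`G² = ¼ Σ_α (L^α)² - ½ G`** (from `Sᵅ_xSᵝ_x = ¼δ_{αβ} + (i/2)ε_{αβγ}Sᵞ_x`
  and `[L^α, L^β] = iε_{αβγ} L^γ`);
* `posSemidef_heisStar_bound`: with the Casimir bound `𝐋² ≤ k(k+2)/4`
  (`posSemidef_casimirBound_sub`), `(k(k+2)/16)·1 - (G² + ½G) ⪰ 0`;
* `heisStar_groundEnergy_ge`: hence the ground energy `E₀` of `G` satisfies
  `E₀² + ½E₀ ≤ k(k+2)/16`, so **`E₀(G) ≥ -(k+2)/4`** (`= -3/2` for `k = 4`; Anderson's `-½S(zS+1)`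
  at `S = ½`, `z = k`; it is attained on the total-spin-`(k-1)/2` multiplet);
* `heisenbergAF_torus_groundEnergy_ge`: on the torus `(ℤ/Lℤ)^d`, `L ≥ 3`,
  `heisenbergHamiltonian 1 (torusGraph d L) 1 = ½ Σ_x G_x` (every bond lies in the stars of its
  two endpoints), so with `E₀(Σ) ≥ Σ E₀` (`Matrix.groundEnergy_sum_ge`)
  **`E₀ ≥ -((d+1)/4)·L^d`**, i.e. `-(d+1)/(4d)` per bond — Anderson's `-3/8 = -0.375` per bond in
  `d = 2` (`-1/2` in `d = 1`, `-1/3` in `d = 3`); the trivial bound is `-3/4` per bond and the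
  numerical value in `d = 2` is `≈ -0.3347`.

No definition is introduced.

## References

* [Anderson1951] P. W. Anderson, *Limits on the Energy of the Antiferromagnetic Ground State*,
  Phys. Rev. 83 (1951) 1260.
* [Tasaki2020] H. Tasaki, *Physics and Mathematics of Quantum Many-Body Systems* (2020), §2.4–2.5.
-/

noncomputable section

open Matrix Complex Finset
open scoped ComplexOrder

namespace Matrix

variable {m : Type*} [Fintype m] [DecidableEq m]

/-- **Ground-energy bound from a quadratic operator inequality**: if `A` is Hermitian and
`C·1 - (A² + b·A) ⪰ 0` (`b`, `C` real) then the ground energy `E₀` of `A` satisfies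
`E₀² + bE₀ ≤ C` (evaluate the form on a normalised ground state). [folklore] -/
theorem groundEnergy_sq_add_le_of_posSemidef [Nonempty m] {A : Matrix m m ℂ} (hA : A.IsHermitian)
    {b C : ℝ} (h : ((C : ℂ) • (1 : Matrix m m ℂ) - (A * A + (b : ℂ) • A)).PosSemidef) :
    A.groundEnergy ^ 2 + b * A.groundEnergy ≤ C := by
  obtain ⟨ψ, hψ1, hψE⟩ := exists_groundState_unit hA
  have hmem : ψ ∈ A.groundSpace := (rayleigh_eq_groundEnergy_iff_holds hA ψ hψ1).1 hψE
  have hAψ : A *ᵥ ψ = (A.groundEnergy : ℂ) • ψ := (mem_groundSpace_iff A ψ).1 hmem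
  -- `⟨ψ, (C - A² - bA) ψ⟩ = C - E₀² - bE₀ ≥ 0`
  have hq := h.dotProduct_mulVec_nonneg ψ
  rw [sub_mulVec, add_mulVec, smul_mulVec, smul_mulVec, one_mulVec, ← mulVec_mulVec, hAψ,
    mulVec_smul, hAψ, smul_smul, smul_smul, dotProduct_sub, dotProduct_add, dotProduct_smul,
    dotProduct_smul, dotProduct_smul, hψ1, smul_eq_mul, mul_one, smul_eq_mul, mul_one, smul_eq_mul,
    mul_one] at hq
  obtain ⟨hre, -⟩ := Complex.nonneg_iff.mp hq
  rw [Complex.sub_re, Complex.add_re, Complex.ofReal_re, ← Complex.ofReal_mul, ← Complex.ofReal_mul,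
    Complex.ofReal_re, Complex.ofReal_re] at hre
  nlinarith [hre]

end Matrix

namespace Literature.MathematicalPhysics.QuantumLattice

variable {Λ : Type*} [Fintype Λ] [DecidableEq Λ]

/-! ### The Heisenberg star `𝐒_x · 𝐋` -/

section HeisStar

/-- The Heisenberg star as `𝐒_x·𝐋`: for `x ∉ Y`, `Σ_{y∈Y} 𝐒_x·𝐒_y = Σ_α Sᵅ_x L^α` with
`L^α = Σ_{y∈Y} Sᵅ_y`. [folklore] -/
theorem heisStar_eq_sum (n : ℕ) {x : Λ} {Y : Finset Λ} (hx : x ∉ Y) :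
    (∑ y ∈ Y, spinDot n x y : Op Λ (n + 1)) =
      ∑ α : Fin 3, siteSpin n x α * ∑ y ∈ Y, siteSpin n y α := by
  rw [Finset.sum_congr rfl fun y hy => spinDot_eq_sum_mul_of_ne n (ne_of_mem_of_not_mem hy hx).symm,
    Finset.sum_comm]
  exact Finset.sum_congr rfl fun α _ => (Finset.mul_sum _ _ _).symm

/-- **The square of the spin-½ Heisenberg star** (`x ∉ Y`): with `G = Σ_{y∈Y} 𝐒_x·𝐒_y` and
`L^α = Σ_{y∈Y} Sᵅ_y`, `G² = ¼ Σ_α (L^α)² - ½ G`. Indeed `G² = Σ_{αβ} Sᵅ_xSᵝ_x L^αL^β`, the diagonal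
gives `¼𝐋²` and the cross terms `(i/2)Sᶻ_x[Lˣ,Lʸ] + cyclic = -½(Sᶻ_xLᶻ + SˣₓLˣ + SʸₓLʸ)`.
[cite: Anderson1951] -/
theorem heisStar_mul_self {x : Λ} {Y : Finset Λ} (hx : x ∉ Y) :
    ((∑ y ∈ Y, spinDot 1 x y : Op Λ 2) * ∑ y ∈ Y, spinDot 1 x y) =
      (1 / 4 : ℂ) • (∑ α : Fin 3, (∑ y ∈ Y, siteSpin 1 y α) * (∑ y ∈ Y, siteSpin 1 y α)) -
        (1 / 2 : ℂ) • ∑ y ∈ Y, spinDot 1 x y := by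
  rw [heisStar_eq_sum 1 hx, Fin.sum_univ_three, Fin.sum_univ_three]
  set Lx : Op Λ 2 := ∑ y ∈ Y, siteSpin 1 y 0 with hLx
  set Ly : Op Λ 2 := ∑ y ∈ Y, siteSpin 1 y 1 with hLy
  set Lz : Op Λ 2 := ∑ y ∈ Y, siteSpin 1 y 2 with hLz
  -- `Sᵅ_x` commutes with every `L^β`
  have c := fun α β => (siteSpin_commute_setSpin 1 hx α β).eq
  -- the nine products `(Sᵅ_x L^α)(Sᵝ_x L^β) = (Sᵅ_xSᵝ_x)(L^αL^β)`
  have e00 : siteSpin 1 x 0 * Lx * (siteSpin 1 x 0 * Lx) = (1 / 4 : ℂ) • (Lx * Lx) := by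
    rw [Matrix.mul_assoc, ← Matrix.mul_assoc Lx, ← c 0 0, Matrix.mul_assoc, ← Matrix.mul_assoc,
      siteSpin_one_mul_self, Matrix.smul_mul, Matrix.one_mul]
  have e11 : siteSpin 1 x 1 * Ly * (siteSpin 1 x 1 * Ly) = (1 / 4 : ℂ) • (Ly * Ly) := by
    rw [Matrix.mul_assoc, ← Matrix.mul_assoc Ly, ← c 1 1, Matrix.mul_assoc, ← Matrix.mul_assoc,
      siteSpin_one_mul_self, Matrix.smul_mul, Matrix.one_mul]
  have e22 : siteSpin 1 x 2 * Lz * (siteSpin 1 x 2 * Lz) = (1 / 4 : ℂ) • (Lz * Lz) := by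
    rw [Matrix.mul_assoc, ← Matrix.mul_assoc Lz, ← c 2 2, Matrix.mul_assoc, ← Matrix.mul_assoc,
      siteSpin_one_mul_self, Matrix.smul_mul, Matrix.one_mul]
  have e01 : siteSpin 1 x 0 * Lx * (siteSpin 1 x 1 * Ly) = (I / 2) • (siteSpin 1 x 2 * (Lx * Ly)) := by
    rw [Matrix.mul_assoc, ← Matrix.mul_assoc Lx, ← c 1 0, Matrix.mul_assoc, ← Matrix.mul_assoc,
      siteSpin_one_x_mul_y, Matrix.smul_mul]
  have e10 : siteSpin 1 x 1 * Ly * (siteSpin 1 x 0 * Lx) =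
      -((I / 2) • (siteSpin 1 x 2 * (Ly * Lx))) := by
    rw [Matrix.mul_assoc, ← Matrix.mul_assoc Ly, ← c 0 1, Matrix.mul_assoc, ← Matrix.mul_assoc,
      siteSpin_one_y_mul_x, Matrix.neg_mul, Matrix.smul_mul]
  have e12 : siteSpin 1 x 1 * Ly * (siteSpin 1 x 2 * Lz) = (I / 2) • (siteSpin 1 x 0 * (Ly * Lz)) := by
    rw [Matrix.mul_assoc, ← Matrix.mul_assoc Ly, ← c 2 1, Matrix.mul_assoc, ← Matrix.mul_assoc,
      siteSpin_one_y_mul_z, Matrix.smul_mul]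
  have e21 : siteSpin 1 x 2 * Lz * (siteSpin 1 x 1 * Ly) =
      -((I / 2) • (siteSpin 1 x 0 * (Lz * Ly))) := by
    rw [Matrix.mul_assoc, ← Matrix.mul_assoc Lz, ← c 1 2, Matrix.mul_assoc, ← Matrix.mul_assoc,
      siteSpin_one_z_mul_y, Matrix.neg_mul, Matrix.smul_mul]
  have e20 : siteSpin 1 x 2 * Lz * (siteSpin 1 x 0 * Lx) = (I / 2) • (siteSpin 1 x 1 * (Lz * Lx)) := by
    rw [Matrix.mul_assoc, ← Matrix.mul_assoc Lz, ← c 0 2, Matrix.mul_assoc, ← Matrix.mul_assoc,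
      siteSpin_one_z_mul_x, Matrix.smul_mul]
  have e02 : siteSpin 1 x 0 * Lx * (siteSpin 1 x 2 * Lz) =
      -((I / 2) • (siteSpin 1 x 1 * (Lx * Lz))) := by
    rw [Matrix.mul_assoc, ← Matrix.mul_assoc Lx, ← c 2 0, Matrix.mul_assoc, ← Matrix.mul_assoc,
      siteSpin_one_x_mul_z, Matrix.neg_mul, Matrix.smul_mul]
  have expand : ∀ a b c : Op Λ 2, (a + b + c) * (a + b + c) =
      a * a + a * b + a * c + (b * a + b * b + b * c) + (c * a + c * b + c * c) := by
    intro a b c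
    simp only [Matrix.add_mul, Matrix.mul_add]
    abel
  rw [expand, e00, e01, e02, e10, e11, e12, e20, e21, e22]
  -- the cross terms via the three commutators `[Lˣ,Lʸ] = iLᶻ` &c.
  have hxy : Lx * Ly - Ly * Lx = I • Lz := setSpin_one_x_mul_y_sub Y
  have hyz : Ly * Lz - Lz * Ly = I • Lx := setSpin_one_y_mul_z_sub Y
  have hzx : Lz * Lx - Lx * Lz = I • Ly := setSpin_one_z_mul_x_sub Y
  have hI : I / 2 * I = -(1 / 2 : ℂ) := by rw [div_mul_eq_mul_div, I_mul_I]; ring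
  have cz : (I / 2) • (siteSpin 1 x 2 * (Lx * Ly)) + -((I / 2) • (siteSpin 1 x 2 * (Ly * Lx))) =
      -((1 / 2 : ℂ) • (siteSpin 1 x 2 * Lz)) := by
    rw [← sub_eq_add_neg, ← smul_sub, ← Matrix.mul_sub, hxy, Matrix.mul_smul, smul_smul, hI, neg_smul]
  have cx : (I / 2) • (siteSpin 1 x 0 * (Ly * Lz)) + -((I / 2) • (siteSpin 1 x 0 * (Lz * Ly))) =
      -((1 / 2 : ℂ) • (siteSpin 1 x 0 * Lx)) := by
    rw [← sub_eq_add_neg, ← smul_sub, ← Matrix.mul_sub, hyz, Matrix.mul_smul, smul_smul, hI, neg_smul]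
  have cy : (I / 2) • (siteSpin 1 x 1 * (Lz * Lx)) + -((I / 2) • (siteSpin 1 x 1 * (Lx * Lz))) =
      -((1 / 2 : ℂ) • (siteSpin 1 x 1 * Ly)) := by
    rw [← sub_eq_add_neg, ← smul_sub, ← Matrix.mul_sub, hzx, Matrix.mul_smul, smul_smul, hI, neg_smul]
  rw [smul_add, smul_add, smul_add, smul_add]
  calc _ = (1 / 4 : ℂ) • (Lx * Lx) + (1 / 4 : ℂ) • (Ly * Ly) + (1 / 4 : ℂ) • (Lz * Lz) +
        (((I / 2) • (siteSpin 1 x 2 * (Lx * Ly)) + -((I / 2) • (siteSpin 1 x 2 * (Ly * Lx)))) +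
          ((I / 2) • (siteSpin 1 x 0 * (Ly * Lz)) + -((I / 2) • (siteSpin 1 x 0 * (Lz * Ly)))) +
          ((I / 2) • (siteSpin 1 x 1 * (Lz * Lx)) + -((I / 2) • (siteSpin 1 x 1 * (Lx * Lz))))) := by
        abel
    _ = _ := by
        rw [cz, cx, cy]
        abel

/-- **The Heisenberg star bound** (spin ½, `x ∉ Y`, `k = |Y|`):
`(k(k+2)/16)·1 - (G² + ½G) = ¼[(k(k+2)/4)·1 - 𝐋²] ⪰ 0`. [cite: Anderson1951] -/
theorem posSemidef_heisStar_bound {x : Λ} {Y : Finset Λ} (hx : x ∉ Y) :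
    ((((Y.card : ℂ) * (Y.card + 2) / 16) • (1 : Op Λ 2)) -
      ((∑ y ∈ Y, spinDot 1 x y) * (∑ y ∈ Y, spinDot 1 x y) +
        (1 / 2 : ℂ) • ∑ y ∈ Y, spinDot 1 x y)).PosSemidef := by
  rw [heisStar_mul_self hx, sub_add_cancel]
  have key : ((((Y.card : ℂ) * (Y.card + 2) / 16) • (1 : Op Λ 2)) -
      (1 / 4 : ℂ) • ∑ α : Fin 3, (∑ y ∈ Y, siteSpin 1 y α) * (∑ y ∈ Y, siteSpin 1 y α)) =
      (1 / 4 : ℂ) • ((((Y.card : ℂ) * (Y.card + 2) / 4) • (1 : Op Λ 2)) -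
        ∑ α : Fin 3, (∑ y ∈ Y, siteSpin 1 y α) * (∑ y ∈ Y, siteSpin 1 y α)) := by
    rw [smul_sub, smul_smul]
    congr 2
    ring
  rw [key]
  have h14 : (0 : ℂ) ≤ 1 / 4 := by
    rw [show (1 / 4 : ℂ) = ((1 / 4 : ℝ) : ℂ) by norm_num]
    exact Complex.zero_le_real.2 (by norm_num)
  exact (posSemidef_casimirBound_sub Y).smul h14

/-- `Σ_{y∈Y} 𝐒_x·𝐒_y` is Hermitian. [folklore] -/
theorem heisStar_isHermitian (n : ℕ) (x : Λ) (Y : Finset Λ) :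
    (∑ y ∈ Y, spinDot n x y : Op Λ (n + 1)).IsHermitian := by
  rw [IsHermitian, conjTranspose_sum]
  exact Finset.sum_congr rfl fun y _ => (spinDot_isHermitian n x y).eq

/-- **Anderson's Heisenberg star energy bound** (spin ½, `x ∉ Y`, `k = |Y|`): the ground energy of
`G = Σ_{y∈Y} 𝐒_x·𝐒_y` is at least `-(k+2)/4`; for `k = z` neighbours this is Anderson's
`-½S(zS+1)` at `S = ½`. [cite: Anderson1951] -/
theorem heisStar_groundEnergy_ge [Nonempty Λ] {x : Λ} {Y : Finset Λ} (hx : x ∉ Y) :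
    -(((Y.card : ℝ) + 2) / 4) ≤ (∑ y ∈ Y, spinDot 1 x y : Op Λ 2).groundEnergy := by
  haveI : Nonempty (TensorIndex Λ 2) := ⟨fun _ => 0⟩
  have hh := heisStar_isHermitian (Λ := Λ) 1 x Y
  have hpsd : (((((Y.card : ℝ) * (Y.card + 2) / 16 : ℝ)) : ℂ) • (1 : Op Λ 2) -
      ((∑ y ∈ Y, spinDot 1 x y) * (∑ y ∈ Y, spinDot 1 x y) +
        (((1 / 2 : ℝ)) : ℂ) • ∑ y ∈ Y, spinDot 1 x y)).PosSemidef := by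
    have h := posSemidef_heisStar_bound hx
    push_cast
    exact h
  have hq := Matrix.groundEnergy_sq_add_le_of_posSemidef hh hpsd
  set E := (∑ y ∈ Y, spinDot 1 x y : Op Λ 2).groundEnergy
  have hk : (0 : ℝ) ≤ Y.card := Nat.cast_nonneg _
  -- `E² + E/2 ≤ k(k+2)/16`, i.e. `(E + (k+2)/4)(E - k/4) ≤ 0`, forces `E ≥ -(k+2)/4`
  nlinarith [hq, hk]

end HeisStar

/-! ### Anderson's bound for the Heisenberg antiferromagnet on the torus -/

section HeisTorus

open Literature.Probability.LatticeModels

variable {d : ℕ} (L : ℕ) [NeZero L]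

/-- **Anderson's lower bound for the spin-½ Heisenberg antiferromagnet on the torus `(ℤ/Lℤ)^d`**
(`L ≥ 3`, any `d`): `E₀(Σ_{⟨xy⟩} 𝐒_x·𝐒_y) ≥ -((d+1)/4)·L^d`, i.e. at least `-(d+1)/(4d)` per bond
(`-3/8` in `d = 2`). Proof: `H = ½ Σ_x G_x` with the Heisenberg stars `G_x = Σ_{y ~ x} 𝐒_x·𝐒_y`
(every bond lies in the stars of its two endpoints), `E₀(Σ) ≥ Σ E₀` and the star bound
`E₀(G_x) ≥ -(2d+2)/4`. [cite: Anderson1951] -/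
theorem heisenbergAF_torus_groundEnergy_ge (hL : 3 ≤ L) :
    -((((d : ℝ) + 1) / 4) * (L : ℝ) ^ d) ≤
      (heisenbergHamiltonian 1 (torusGraph d L) 1).groundEnergy := by
  haveI : Nonempty (TensorIndex (TorusSite d L) 2) := ⟨fun _ => 0⟩
  have hL2 : 2 ≤ L := by omega
  -- stars
  set nbr : TorusSite d L → Fin d × Bool → TorusSite d L := fun x p =>
    if p.2 then x + Pi.single p.1 (1 : ZMod L) else x - Pi.single p.1 1 with hnbr
  set Y : TorusSite d L → Finset (TorusSite d L) := fun x => Finset.univ.image (nbr x) with hY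
  set T : TorusSite d L → Op (TorusSite d L) 2 := fun x => ∑ y ∈ Y x, spinDot 1 x y with hT
  have hne : ∀ (x : TorusSite d L) (i : Fin d), x ≠ x + Pi.single i 1 := by
    intro x i h
    exact single_ne_zero_of_two_le L hL2 i (by simpa using h.symm)
  have hne' : ∀ (x : TorusSite d L) (i : Fin d), x ≠ x - Pi.single i 1 := by
    intro x i h
    exact single_ne_zero_of_two_le L hL2 i (by simpa [sub_eq_add_neg] using h.symm)
  have hxY : ∀ x, x ∉ Y x := by
    intro x hx
    rw [hY, Finset.mem_image] at hx
    obtain ⟨⟨i, b⟩, -, hb⟩ := hx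
    cases b
    · exact hne' x i (by simpa [hnbr] using hb.symm)
    · exact hne x i (by simpa [hnbr] using hb.symm)
  have hcard : ∀ x, (Y x).card = 2 * d := by
    intro x
    rw [hY, Finset.card_image_of_injective _ (torusNbr_injective L hL x), Finset.card_univ,
      Fintype.card_prod, Fintype.card_fin, Fintype.card_bool, mul_comm]
  -- `G_x = Σᵢ (𝐒_x·𝐒_{x+eᵢ} + 𝐒_x·𝐒_{x-eᵢ})`
  have hTsum : ∀ x, T x =
      ∑ i : Fin d, (spinDot 1 x (x + Pi.single i 1) + spinDot 1 x (x - Pi.single i 1)) := by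
    intro x
    rw [hT]
    dsimp only
    rw [hY, Finset.sum_image fun p _ q _ h => torusNbr_injective L hL x h, Fintype.sum_prod_type]
    refine Finset.sum_congr rfl fun i _ => ?_
    rw [Fintype.sum_bool]
    rfl
  -- `H = Σ_x Σᵢ 𝐒_x·𝐒_{x+eᵢ}`
  have hH : heisenbergHamiltonian 1 (torusGraph d L) 1 =
      ∑ x : TorusSite d L, ∑ i : Fin d, spinDot 1 x (x + Pi.single i 1) := by
    unfold heisenbergHamiltonian
    rw [Complex.ofReal_one, one_smul, ← sum_pairs_eq_sum_edgeFinset' L hL]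
    rfl
  -- `Σ_x 𝐒_x·𝐒_{x-eᵢ} = Σ_x 𝐒_x·𝐒_{x+eᵢ}`
  have hshift : ∀ i : Fin d, ∑ x : TorusSite d L, spinDot 1 x (x - Pi.single i 1) =
      ∑ x : TorusSite d L, spinDot 1 x (x + Pi.single i 1) := by
    intro i
    rw [← Equiv.sum_comp (Equiv.addRight (Pi.single i (1 : ZMod L)))]
    refine Finset.sum_congr rfl fun x _ => ?_
    simp only [Equiv.coe_addRight, add_sub_cancel_right]
    exact spinDot_comm 1 x _
  have hminus : (∑ x : TorusSite d L, ∑ i : Fin d, spinDot 1 x (x - Pi.single i 1)) =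
      ∑ x : TorusSite d L, ∑ i : Fin d, spinDot 1 x (x + Pi.single i 1) := by
    rw [Finset.sum_comm, Finset.sum_congr rfl fun i _ => hshift i, Finset.sum_comm]
  have h2 : (2 : ℂ) • heisenbergHamiltonian 1 (torusGraph d L) 1 = ∑ x : TorusSite d L, T x := by
    rw [two_smul, hH, Finset.sum_congr rfl fun x _ => hTsum x]
    simp only [Finset.sum_add_distrib]
    rw [hminus]
  have hH' : heisenbergHamiltonian 1 (torusGraph d L) 1 =
      ∑ x : TorusSite d L, (((1 / 2 : ℝ) : ℂ) • T x) := by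
    calc heisenbergHamiltonian 1 (torusGraph d L) 1
        = (1 / 2 : ℂ) • ((2 : ℂ) • heisenbergHamiltonian 1 (torusGraph d L) 1) := by
          rw [smul_smul]; norm_num
      _ = (1 / 2 : ℂ) • ∑ x : TorusSite d L, T x := by rw [h2]
      _ = ∑ x : TorusSite d L, (((1 / 2 : ℝ) : ℂ) • T x) := by
          rw [Finset.smul_sum]
          push_cast
          rfl
  have hTh : ∀ x, (T x).IsHermitian := fun x => heisStar_isHermitian 1 x (Y x)
  -- assemble
  rw [hH']
  refine le_trans ?_ (Matrix.groundEnergy_sum_ge _ fun x _ => (hTh x).ofReal_smul _)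
  have hstar : ∀ x : TorusSite d L, -(((d : ℝ) + 1) / 4) ≤
      ((((1 / 2 : ℝ) : ℂ) • T x).groundEnergy) := by
    intro x
    rw [Matrix.groundEnergy_smul_of_pos (hTh x) (by norm_num : (0 : ℝ) < 1 / 2)]
    have h := heisStar_groundEnergy_ge (Λ := TorusSite d L) (hxY x)
    rw [hcard x] at h
    push_cast at h
    have : -(((d : ℝ) + 1) / 4) = 1 / 2 * (-((2 * (d : ℝ) + 2) / 4)) := by ring
    rw [this]
    exact mul_le_mul_of_nonneg_left h (by norm_num)
  calc -((((d : ℝ) + 1) / 4) * (L : ℝ) ^ d)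
      = ∑ _x : TorusSite d L, -(((d : ℝ) + 1) / 4) := by
        rw [Finset.sum_const, Finset.card_univ, nsmul_eq_mul]
        have : (Fintype.card (TorusSite d L) : ℝ) = (L : ℝ) ^ d := by
          rw [show Fintype.card (TorusSite d L) = L ^ d by
            rw [Fintype.card_fun, ZMod.card, Fintype.card_fin]]
          push_cast; ring
        rw [this]; ring
    _ ≤ ∑ x : TorusSite d L, ((((1 / 2 : ℝ) : ℂ) • T x).groundEnergy) :=
        Finset.sum_le_sum fun x _ => hstar x

end HeisTorus

end Literature.MathematicalPhysics.QuantumLattice
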